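import Literature.Geometry.Kaehler.ComplexTorusUnimodularMorphismSplitting
import Literature.Geometry.Kaehler.ComplexTorusUnimodularProductPairs
import Literature.Geometry.Kaehler.ComplexTorusPolarizedDecompositionGroupings
import Literature.Geometry.Kaehler.ComplexTorusPolarizedDecompositionSubtorus
import HarnessLib

/-!
# Irreducible principally polarized complex tori (Clemens–Griffiths Def. 3.22): irreducible ⟺
# indecomposable, and Cor. 3.23 — a p.p.a.v. decomposes uniquely into irreducible p.p.a.v.'s

Layer `Literature/Geometry/Kaehler`, namespace `Literature.Geometry.Kaehler.ComplexTorus`; lane `lit-hodgefound`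
(Track 2 foundations library, Layer A2 «polarisations … products of polarised tori»; prover seat `lit-hodgefound-p26`,
gen 13, row g13-#2). ONE definition with body (`ComplexTorus.IsPolarizedIrreducible`, C–G's Definition 3.22) +
theorems; NO named fact, net debt `0`.

## Source, VERBATIM

C. H. Clemens, P. A. Griffiths, *The intermediate Jacobian of the cubic threefold*, Ann. of Math. 95 (1972) 281–356,
§3 (held `paper:doi-10-2307-1970801` p0014, p0018):

* p. 293, Def. 3.5 and after: "The triple `(W, U, ℋ)` is called a principally polarized complex torus. In the category
  of principally polarized complex tori, the notion of morphism will be the strong one, namely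
  `(W₁, U₁, ℋ₁) → (W₂, U₂, ℋ₂)` means a linear transformation `α : W₁ → W₂` such that `α(U₁) ⊂ U₂` and
  `ℋ₁ = (ℋ₂)_α`, the 'pullback' of `ℋ₂` under `α`. This implies that `α : W₁ → W₂` is injective and that `α(U₁)` is a
  direct summand of `U₂` […] we obtain a direct sum decomposition: (3.6)
  `(W₁, U₁, ℋ₁) ⊕ (W₁^⊥, U₁^⊥, ℋ₂|_{W₁^⊥}) ≅ (W₂, U₂, ℋ₂)`."
* p. 297: "**Definition 3.22.** A principally polarized complex torus `𝒯` is irreducible if for any morphism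
  `φ : 𝒯' → 𝒯` either `𝒯' = 0` or `φ` is an isomorphism. Since the direct summands of `𝒯` in Lemma 3.20 were
  constructed intrinsically from the components of `Θ(𝒯)`, we have: **Corollary 3.23.** If `𝒯` is a principally
  polarized abelian variety, `𝒯` has a unique decomposition into the direct sum of irreducible principally
  polarized abelian varieties. `𝒯` itself is irreducible if and only if `Θ(𝒯)` is irreducible."

## Dictionary (the tree's analytic carrier)

A principally polarized complex torus `𝒯 = (W, U, ℋ)` is `X = E/Φ(ℤ^ι)` with a real `2`-form `η = Im ℋ` of type
`(1,1)` whose integral lattice form `B` (`B m n = η(Φm, Φn)`, `hB`) is unimodular on `Λ = ℤ^ι` — equivalently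
`|deg (X, η)| = |polarizationDegree Φ η| = 1` (`isUnimodular_iff_abs_polarizationDegree`); no positivity. A MORPHISM
`φ : 𝒯' → 𝒯` is, as in `ComplexTorusUnimodularMorphismSplitting.lean` (g12-#4), a homomorphism of tori `ρ(M)`
(`M : Matrix ι ι₁ ℤ`, `U' = ℤ^{ι₁} ↦ U`) with `ℂ`-linear analytic representation `α = F : E₁ →L[ℂ] E`,
`Φ ∘ M_ℝ = F ∘ Φ₁` (`hF`), the source carrying the pulled-back form `ℋ' = (ℋ)_α`, i.e. `η' = F^*η = pullbackForm F η`
(so `𝒯'` is an object of the category iff `|deg (X₁, F^*η)| = 1`); «`φ` is an isomorphism» = `ρ(M)` underlies an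
isomorphism of polarised tori (`IsPolarizedIso`); «`𝒯' = 0`» = `W' = 0`, i.e. the lattice index type `ι₁` is empty.
«`𝒯` is a product `𝒯₁ ⊕ 𝒯₂` of non-zero p.p. tori» is p16's `IsPolarizedDecomposable Φ η` (a product pair `(V, W)`
with `V, W ≠ 0`; `IsProductPair.exists_isPolarizedIso_addition`); the polarised abelian subvariety on a complex
lattice subspace `U` is `(ComplexTorus (subtorusPeriod Φ U hU hUc), η|_U)`, `η|_U = pullbackForm (cxSpan Φ U).subtypeL η`,
and «indecomposable» for it is `IsIndecomposable Φ η U` (`ComplexTorusPolarizedDecompositionUnique/Subtorus`).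

## Contents

* §1 `IsPolarizedIrreducible Φ η` — **Definition 3.22** (a `Prop`; the sources `𝒯'` range over all complex tori
  `E₁/Φ₁(ℤ^{ι₁})` with `E₁` in the universe of `E`, all `M`, `F`).
* §2 **irreducible ⟹ indecomposable** (`IsPolarizedIrreducible.eq_bot_or_eq_bot`,
  `IsPolarizedIrreducible.not_isPolarizedDecomposable`): a product pair `(V, W)` with `V, W ≠ 0` yields the
  inclusion morphism `(Y, η|_Y) → (X, η)` of the factor — a p.p. complex torus by g13-#1's
  `IsProductPair.abs_polarizationDegree_restrict_eq_one` — which is neither `0` nor an isomorphism (dimension).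
* §3 **indecomposable ⟹ irreducible** (`isPolarizedIrreducible_of_not_isPolarizedDecomposable`): by g12-#4's (3.6)
  the image of a morphism and its `η`-orthogonal form a product pair (`isProductPair_range_orthSubspace`); if the
  image is `0` then `W' = 0` (`α` is injective, `analyticRep_injective_of_isUnimodular`); if the complement is `0`
  then `M(ℤ^{ι₁}) = ℤ^ι` (primitivity `subLattice_range_eq_range_mulVecLin` + injectivity
  `mulVec_injective_of_isUnimodular`), so `M` has an integer inverse and `ρ(M)` is an isomorphism of polarised tori
  (`exists_isPolarizedIso_of_matrix`).
* §4 **`IsPolarizedIrreducible Φ η ↔ ¬ IsPolarizedDecomposable Φ η`** for a principally polarized complex torus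
  (`isPolarizedIrreducible_iff_not_isPolarizedDecomposable`, `B`-free `…_of_abs_polarizationDegree`), the unimodular
  criterion `isPolarizedIrreducible_iff_forall_not_isUnimodular_subLattice` (g13-#1), and validation
  `isPolarizedIrreducible_of_card_lt_four` (p.p. tori of dimension `≤ 1` are irreducible).
* §5 **Corollary 3.23 (first assertion)** for a principally polarised abelian variety `(X, Θ)`
  (`IsPrincipalPolarization`): `IsProductFamily.isProductPair_iSup_ne` (a factor and the sum of the others form a
  product pair), `IsProductFamily.isPrincipalPolarization_restrict` (the factors of a p.p.a.v. are p.p.a.v.'s),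
  `isIndecomposable_iff_isPolarizedIrreducible` (for a principally polarised factor:
  indecomposable ⟺ irreducible in the sense of Def. 3.22), and
  **`IsPrincipalPolarization.clemensGriffiths_3_23`**: there is EXACTLY ONE set `D` of abelian subvarieties with
  `(X, Θ) = ∏_{Y ∈ D} (Y, Θ|_Y)` (a product family) all of whose factors are IRREDUCIBLE principally polarized
  abelian varieties — existence and uniqueness being the tree's Debarre/Eichler–Kneser theorem
  `IsRiemannForm.existsUnique_isProductFamily_isIndecomposable`, here re-expressed in C–G's vocabulary.

Honest scope — NOT here: the second assertion of Cor. 3.23 («`𝒯` is irreducible iff `Θ(𝒯)` is irreducible») and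
Lemma 3.20 (the decomposition read off the components of the theta divisor), which need the divisor theory of
`Θ`; C–G's proof of uniqueness goes through Lemma 3.20, the tree's through the Eichler–Kneser theorem (Debarre 1996).
-- TODO(general form): none.

## References

* [ClemensGriffiths1972] C. H. Clemens, P. A. Griffiths, The intermediate Jacobian of the cubic threefold, Ann. of
  Math. (2) 95 (1972) 281–356, §3 Def. 3.5, (3.6) (p. 293), Def. 3.22, Cor. 3.23 (p. 297).
* [Debarre1996PolarisationsProduits] O. Debarre, Polarisations sur les variétés abéliennes produits, C. R. Acad.
  Sci. Paris 323 (1996) 631–635, Corollaire 2.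
* [Lange2023AbelianVarietiesComplex] H. Lange, Abelian Varieties over the Complex Numbers, Springer 2023, §1.1.2
  Prop. 1.1.6, Prop. 1.1.10; §2.4.4 Cor. 2.4.31; §3.1.2 Prop. 3.1.4.
-/

noncomputable section

open Module Function Complex Submodule
open scoped Matrix
open LinearMap (BilinForm)

namespace Literature.Geometry.Kaehler

namespace ComplexTorus

universe u

variable {ι : Type*} [Fintype ι] [DecidableEq ι] {E : Type u} [NormedAddCommGroup E] [NormedSpace ℂ E]

/-! ## §1 Definition 3.22 -/

section Def

/-- **An irreducible principally polarized complex torus (Clemens–Griffiths, Definition 3.22)**: "A principally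
polarized complex torus `𝒯` is irreducible if for any morphism `φ : 𝒯' → 𝒯` either `𝒯' = 0` or `φ` is an
isomorphism." Here `𝒯 = (X = E/Φ(ℤ^ι), η)`; a morphism `φ : 𝒯' → 𝒯` from a principally polarized complex torus
`𝒯' = (E₁/Φ₁(ℤ^{ι₁}), η')` is a homomorphism `ρ(M)` with `ℂ`-linear analytic representation `F` (`Φ ∘ M_ℝ = F ∘ Φ₁`:
"`α(U₁) ⊂ U₂`") and `η' = F^*η` ("`ℋ₁ = (ℋ₂)_α`"), the source being principally polarized: `|deg (X₁, F^*η)| = 1`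
("`Im ℋ` integral-valued and unimodular on `U`", Def. 3.5); "`𝒯' = 0`" reads `ι₁ = ∅` (`W' = 0`) and "`φ` is an
isomorphism" reads: `ρ(M)` underlies an isomorphism of polarised tori `(X₁, F^*η) ⥲ (X, η)` (`IsPolarizedIso`).
The sources range over all index types `ι₁ : Type` and all `E₁` in the universe of `E`.
[cite: ClemensGriffiths1972, §3 Def. 3.22, p. 297] [cite: ClemensGriffiths1972, §3 Def. 3.5, p. 293] -/
def IsPolarizedIrreducible (Φ : (ι → ℝ) ≃L[ℝ] E) (η : E [⋀^Fin 2]→L[ℝ] ℝ) : Prop :=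
  ∀ ⦃ι₁ : Type⦄ [Fintype ι₁] [DecidableEq ι₁] ⦃E₁ : Type u⦄ [NormedAddCommGroup E₁] [NormedSpace ℂ E₁]
    (Φ₁ : (ι₁ → ℝ) ≃L[ℝ] E₁) (M : Matrix ι ι₁ ℤ) (F : E₁ →L[ℂ] E),
    (∀ x, Φ ((M.map (Int.cast : ℤ → ℝ)) *ᵥ x) = F (Φ₁ x)) →
    |polarizationDegree Φ₁ (pullbackForm F η)| = 1 →
    IsEmpty ι₁ ∨ ∃ h : ComplexTorus Φ₁ ≃+ ComplexTorus Φ,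
      IsPolarizedIso Φ₁ (pullbackForm F η) Φ η h ∧ ⇑h = mapMatrix Φ₁ Φ M

omit [DecidableEq ι] in
/-- Unfolding Definition 3.22 at a given morphism `φ = ρ(M) : (X₁, F^*η) → (X, η)` of principally polarized
complex tori: `X₁ = 0` or `φ` is an isomorphism of polarised tori. [cite: ClemensGriffiths1972, §3 Def. 3.22, p. 297] -/
theorem IsPolarizedIrreducible.isEmpty_or_exists_isPolarizedIso {Φ : (ι → ℝ) ≃L[ℝ] E} {η : E [⋀^Fin 2]→L[ℝ] ℝ}
    (h : IsPolarizedIrreducible Φ η)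
    {ι₁ : Type} [Fintype ι₁] [DecidableEq ι₁] {E₁ : Type u} [NormedAddCommGroup E₁] [NormedSpace ℂ E₁]
    (Φ₁ : (ι₁ → ℝ) ≃L[ℝ] E₁) {M : Matrix ι ι₁ ℤ} {F : E₁ →L[ℂ] E}
    (hF : ∀ x, Φ ((M.map (Int.cast : ℤ → ℝ)) *ᵥ x) = F (Φ₁ x)) (hdeg : |polarizationDegree Φ₁ (pullbackForm F η)| = 1) :
    IsEmpty ι₁ ∨ ∃ h : ComplexTorus Φ₁ ≃+ ComplexTorus Φ,
      IsPolarizedIso Φ₁ (pullbackForm F η) Φ η h ∧ ⇑h = mapMatrix Φ₁ Φ M :=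
  h Φ₁ M F hF hdeg

end Def

variable (Φ : (ι → ℝ) ≃L[ℝ] E) {η : E [⋀^Fin 2]→L[ℝ] ℝ} {B : LinearMap.BilinForm ℤ (ι → ℤ)}
  {V W : Submodule ℝ (ι → ℝ)}

/-! ## §2 Irreducible ⟹ indecomposable: a non-trivial factor embeds by a morphism which is neither `0` nor an
isomorphism -/

section ToIndecomposable

/-- **An irreducible principally polarized complex torus has no product decomposition with two non-zero
factors**: for a product pair `(V, W)` of `(X, η)` (`η` integral on `Λ` with `|deg (X, η)| = 1`), `V = 0` or `W = 0`.
The inclusion `ι_Y : (Y, η|_Y) → (X, η)` of the factor `Y = π(V)` is a morphism of principally polarized complex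
tori (`|deg (Y, η|_Y)| = 1`, g13-#1); if `Y = 0` then `V = 0`, and if `ι_Y` is an isomorphism then `rk Λ_Y = rk Λ`,
so `V = Λ ⊗ ℝ` and `W = 0`. [cite: ClemensGriffiths1972, §3 Def. 3.22 and (3.6), pp. 293, 297] -/
theorem IsPolarizedIrreducible.eq_bot_or_eq_bot (h : IsPolarizedIrreducible Φ η)
    (hint : ∀ m n : ι → ℤ, ∃ k : ℤ, η ![Φ (intVec m), Φ (intVec n)] = k) (h1 : |polarizationDegree Φ η| = 1)
    (hp : IsProductPair Φ η V W) : V = ⊥ ∨ W = ⊥ := by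
  have hV := hp.isLatticeSubspace_left
  have hVc := hp.isComplexSubspace_left
  have hdeg := (hp.abs_polarizationDegree_restrict_eq_one Φ hint h1).1
  rcases h (subtorusPeriod Φ V hV hVc) (subtorusMatrix V) (cxSpan Φ V).subtypeL
      (apply_mulVec_subtorusMatrix Φ V hV hVc) hdeg with he | ⟨e, he, -⟩
  · left
    haveI := he
    have hr : subRank V = 0 := by
      rw [← Fintype.card_fin (subRank V)]
      exact Fintype.card_eq_zero
    have hfin : finrank ℝ V = 0 := by rw [finrank_eq_subRank hV, hr]
    exact Submodule.finrank_eq_zero.1 hfin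
  · right
    have hcard := he.isIsomorphic.card_eq
    rw [Fintype.card_fin] at hcard
    have hfin : finrank ℝ V = finrank ℝ (ι → ℝ) := by
      rw [finrank_eq_subRank hV, hcard, Module.finrank_fintype_fun_eq_card]
    have hVtop : V = ⊤ := Submodule.eq_top_of_finrank_eq hfin
    have hc := hp.isCompl
    rw [hVtop] at hc
    exact hc.disjoint.eq_bot_of_ge le_top

/-- **Irreducible ⟹ indecomposable** (`IsPolarizedDecomposable`: a product of two non-zero polarised tori).
[cite: ClemensGriffiths1972, §3 Def. 3.22, p. 297] -/
theorem IsPolarizedIrreducible.not_isPolarizedDecomposable (h : IsPolarizedIrreducible Φ η)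
    (hint : ∀ m n : ι → ℤ, ∃ k : ℤ, η ![Φ (intVec m), Φ (intVec n)] = k) (h1 : |polarizationDegree Φ η| = 1) :
    ¬ IsPolarizedDecomposable Φ η := by
  rintro ⟨V, W, hV0, hW0, hp⟩
  exact (h.eq_bot_or_eq_bot Φ hint h1 hp).elim hV0 hW0

end ToIndecomposable

/-! ## §3 Indecomposable ⟹ irreducible: by (3.6) the image of a morphism is a direct factor -/

section ToIrreducible

variable (hB : ∀ m n : ι → ℤ, (B m n : ℝ) = η ![Φ (intVec m), Φ (intVec n)])
include hB

omit [Fintype ι] [DecidableEq ι] in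
/-- The pull-back `F^*η` along a homomorphism `ρ(M)` with analytic representation `F` is integral on the source
lattice: `F^*η(Φ₁m, Φ₁n) = B(Mm, Mn)` («`α(U₁) ⊂ U₂`»). [cite: ClemensGriffiths1972, §3 Def. 3.5, p. 293] -/
theorem integral_pullbackForm_of_analyticRep {ι₁ : Type*} [Fintype ι₁] {E₁ : Type*} [NormedAddCommGroup E₁]
    [NormedSpace ℂ E₁] (Φ₁ : (ι₁ → ℝ) ≃L[ℝ] E₁) {M : Matrix ι ι₁ ℤ} {F : E₁ →L[ℂ] E}
    (hF : ∀ x, Φ ((M.map (Int.cast : ℤ → ℝ)) *ᵥ x) = F (Φ₁ x)) :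
    ∀ m n : ι₁ → ℤ, ∃ k : ℤ, pullbackForm F η ![Φ₁ (intVec m), Φ₁ (intVec n)] = k := fun m n ↦
  ⟨B (M *ᵥ m) (M *ᵥ n), by rw [pullbackForm_apply, ← hF, ← hF, intVec_mulVec, intVec_mulVec, ← hB]⟩

/-- **Indecomposable ⟹ irreducible.** Let `(X, η)` be a complex torus with `η` of type `(1,1)` and integral lattice
form `B` (unimodularity of `B` on `Λ` is not needed for this direction) admitting no product decomposition into two
non-zero factors, and let
`φ = ρ(M) : (X₁, F^*η) → (X, η)` be a morphism from a principally polarized complex torus. By (3.6)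
`(Im φ, (Im φ)^⊥)` is a product pair of `(X, η)` (g12-#4 `isProductPair_range_orthSubspace`), so `Im φ = 0` — then
`X₁ = 0`, as `α = F` is injective — or `(Im φ)^⊥ = 0` — then `M_ℝ` is onto, `M(ℤ^{ι₁}) = Λ ∩ Im M_ℝ = Λ` (primitivity)
and `M` is injective, so `M` is invertible over `ℤ` and `φ` is an isomorphism of polarised tori.
[cite: ClemensGriffiths1972, §3 Def. 3.22 and (3.6), pp. 293, 297] [cite: Lange2023AbelianVarietiesComplex, §1.1.2 Prop. 1.1.6 and §3.1.2 Prop. 3.1.4] -/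
theorem isPolarizedIrreducible_of_not_isPolarizedDecomposable (h₁₁ : ∀ u v : E, η ![I • u, I • v] = η ![u, v])
    (hX : ¬ IsPolarizedDecomposable Φ η) : IsPolarizedIrreducible Φ η := by
  intro ι₁ _ _ E₁ _ _ Φ₁ M F hF hdeg
  obtain ⟨B₁, hB₁⟩ := exists_bilinForm_int_of_integral (integral_pullbackForm_of_analyticRep Φ hB Φ₁ hF)
  have h₁ : B₁.IsUnimodular := (isUnimodular_iff_abs_polarizationDegree Φ₁ hB₁).2 hdeg
  have hp := isProductPair_range_orthSubspace Φ₁ Φ hF hB hB₁ h₁ h₁₁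
  by_cases hR0 : LinearMap.range (M.map (Int.cast : ℤ → ℝ)).mulVecLin = ⊥
  · -- `Im φ = 0`: the source is `0`
    left
    by_contra hne
    rw [not_isEmpty_iff] at hne
    obtain ⟨i⟩ := hne
    have hFinj := analyticRep_injective_of_isUnimodular Φ₁ Φ hF hB hB₁ h₁
    have hx : (M.map (Int.cast : ℤ → ℝ)) *ᵥ (Pi.single i 1 : ι₁ → ℝ) = 0 := by
      have hmem : (M.map (Int.cast : ℤ → ℝ)) *ᵥ (Pi.single i 1 : ι₁ → ℝ) ∈
          LinearMap.range (M.map (Int.cast : ℤ → ℝ)).mulVecLin := LinearMap.mem_range_self _ _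
      rw [hR0, Submodule.mem_bot] at hmem
      exact hmem
    have h0 : Φ₁ (Pi.single i 1) = 0 := hFinj (by rw [← hF, hx, map_zero, map_zero])
    have h0' : (Pi.single i (1 : ℝ) : ι₁ → ℝ) = 0 := Φ₁.injective (by rw [h0, map_zero])
    have hi := congr_fun h0' i
    simp at hi
  · -- `(Im φ)^⊥ = 0`: `M_ℝ` is onto and `M` is invertible over `ℤ`
    right
    have hW0 : orthSubspace Φ η (LinearMap.range (M.map (Int.cast : ℤ → ℝ)).mulVecLin) = ⊥ := by
      by_contra hW0
      exact hX ⟨_, _, hR0, hW0, hp⟩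
    have hc := hp.isCompl
    rw [hW0] at hc
    have hRtop : LinearMap.range (M.map (Int.cast : ℤ → ℝ)).mulVecLin = ⊤ := eq_top_of_isCompl_bot hc
    have hM := map_mulVec_eq_of_pullbackForm Φ₁ Φ hF hB hB₁
    have hinj : Injective M.mulVecLin := mulVec_injective_of_isUnimodular M h₁ hM
    have hsurj : Surjective M.mulVecLin := by
      rw [← LinearMap.range_eq_top, ← subLattice_range_eq_range_mulVecLin Φ₁ Φ hF hB hB₁ h₁, hRtop, subLattice_top]
    let e : (ι₁ → ℤ) ≃ₗ[ℤ] (ι → ℤ) := LinearEquiv.ofBijective M.mulVecLin ⟨hinj, hsurj⟩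
    have he : ∀ x, e x = M *ᵥ x := fun _ ↦ rfl
    set N : Matrix ι₁ ι ℤ := LinearMap.toMatrix' (e.symm : (ι → ℤ) →ₗ[ℤ] (ι₁ → ℤ)) with hN
    have hNM : N * M = 1 := by
      have hcomp : (e.symm : (ι → ℤ) →ₗ[ℤ] (ι₁ → ℤ)) ∘ₗ Matrix.toLin' M = LinearMap.id := by
        apply LinearMap.ext
        intro x
        rw [LinearMap.comp_apply, Matrix.toLin'_apply, LinearMap.id_apply, ← he]
        exact e.symm_apply_apply x
      rw [hN, ← LinearMap.toMatrix'_toLin' M, ← LinearMap.toMatrix'_comp, hcomp, LinearMap.toMatrix'_id]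
    have hMN : M * N = 1 := by
      have hcomp : Matrix.toLin' M ∘ₗ (e.symm : (ι → ℤ) →ₗ[ℤ] (ι₁ → ℤ)) = LinearMap.id := by
        apply LinearMap.ext
        intro y
        rw [LinearMap.comp_apply, Matrix.toLin'_apply, LinearMap.id_apply, ← he]
        exact e.apply_symm_apply y
      rw [hN, ← LinearMap.toMatrix'_toLin' M, ← LinearMap.toMatrix'_comp, hcomp, LinearMap.toMatrix'_id]
    obtain ⟨h, hh, hcoe, -⟩ := exists_isPolarizedIso_of_matrix (Φ := Φ₁) (Φ' := Φ) (η := pullbackForm F η)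
      (η' := η) hNM hMN F hF fun u v ↦ (pullbackForm_apply F η u v).symm
    exact ⟨h, hh, hcoe⟩

/-! ## §4 Irreducible ⟺ indecomposable ⟺ no proper non-zero unimodular complex subtorus -/

/-- **Definition 3.22 ⟺ indecomposability**: a principally polarized complex torus `(X, η)` (`η` of type `(1,1)`,
integral lattice form `B` unimodular; no positivity) is irreducible in the sense of Clemens–Griffiths iff it is
NOT the product of two non-zero polarised tori. [cite: ClemensGriffiths1972, §3 Def. 3.22 and (3.6), pp. 293, 297] -/
theorem isPolarizedIrreducible_iff_not_isPolarizedDecomposable (h₁₁ : ∀ u v : E, η ![I • u, I • v] = η ![u, v])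
    (hu : B.IsUnimodular) : IsPolarizedIrreducible Φ η ↔ ¬ IsPolarizedDecomposable Φ η :=
  ⟨fun h ↦ h.not_isPolarizedDecomposable Φ (integral_of_intForm Φ hB)
      ((isUnimodular_iff_abs_polarizationDegree Φ hB).1 hu),
    isPolarizedIrreducible_of_not_isPolarizedDecomposable Φ hB h₁₁⟩

/-- **Irreducible ⟺ no complex subtorus `0 ≠ Y ≠ X` carries a unimodular `B|_{Λ_Y}`** (g13-#1's classification
of the product decompositions). [cite: ClemensGriffiths1972, §3 Def. 3.5, (3.6) and Def. 3.22, pp. 293, 297] -/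
theorem isPolarizedIrreducible_iff_forall_not_isUnimodular_subLattice (h₁₁ : ∀ u v : E, η ![I • u, I • v] = η ![u, v])
    (hu : B.IsUnimodular) :
    IsPolarizedIrreducible Φ η ↔ ∀ V : Submodule ℝ (ι → ℝ), IsLatticeSubspace V → IsComplexSubspace Φ V →
      V ≠ ⊥ → V ≠ ⊤ → ¬ (B.restrict (subLattice V)).IsUnimodular := by
  rw [isPolarizedIrreducible_iff_not_isPolarizedDecomposable Φ hB h₁₁ hu,
    isPolarizedDecomposable_iff_exists_isUnimodular_subLattice Φ hB h₁₁ hu]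
  simp only [not_exists, not_and]

omit hB

/-- The `B`-free phrasing: for `η` of type `(1,1)`, integral on `Λ`, with `|deg (X, η)| = 1`:
irreducible ⟺ indecomposable. [cite: ClemensGriffiths1972, §3 Def. 3.5 and Def. 3.22, pp. 293, 297] -/
theorem isPolarizedIrreducible_iff_not_isPolarizedDecomposable_of_abs_polarizationDegree
    (h₁₁ : ∀ u v : E, η ![I • u, I • v] = η ![u, v])
    (hint : ∀ m n : ι → ℤ, ∃ k : ℤ, η ![Φ (intVec m), Φ (intVec n)] = k) (h1 : |polarizationDegree Φ η| = 1) :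
    IsPolarizedIrreducible Φ η ↔ ¬ IsPolarizedDecomposable Φ η := by
  obtain ⟨B, hB⟩ := exists_bilinForm_int_of_integral hint
  exact isPolarizedIrreducible_iff_not_isPolarizedDecomposable Φ hB h₁₁
    ((isUnimodular_iff_abs_polarizationDegree Φ hB).2 h1)

/-- **Validation: principally polarized complex tori of dimension `≤ 1` (`rk Λ < 4`) are irreducible** — a
product of two non-zero tori has `rk Λ ≥ 4`. [cite: ClemensGriffiths1972, §3 Def. 3.22, p. 297] -/
theorem isPolarizedIrreducible_of_card_lt_four (h₁₁ : ∀ u v : E, η ![I • u, I • v] = η ![u, v])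
    (hint : ∀ m n : ι → ℤ, ∃ k : ℤ, η ![Φ (intVec m), Φ (intVec n)] = k) (h1 : |polarizationDegree Φ η| = 1)
    (hι : Fintype.card ι < 4) : IsPolarizedIrreducible Φ η :=
  (isPolarizedIrreducible_iff_not_isPolarizedDecomposable_of_abs_polarizationDegree Φ h₁₁ hint h1).2
    (not_isPolarizedDecomposable_of_card_lt_four Φ hι)

end ToIrreducible

/-! ## §5 Corollary 3.23: a principally polarized abelian variety is uniquely a product of irreducible ones -/

section Cor323

omit [Fintype ι] [DecidableEq ι] in
/-- The grouping of a product family into "the factor `i`" and "all the other factors" is the product family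
`b ↦ cond b (Xᵢ) (⨆_{j ≠ i} Xⱼ)`. Private plumbing. [folklore] -/
private theorem pI_fiber_decide_eq {κ : Type*} [DecidableEq κ] (X : κ → Submodule ℝ (ι → ℝ)) (i : κ) :
    (fun b : Bool ↦ ⨆ (j : κ) (_ : decide (j = i) = b), X j) =
      fun b : Bool ↦ cond b (X i) (⨆ (j : κ) (_ : j ≠ i), X j) := by
  funext b
  cases b with
  | false =>
    change (⨆ (j : κ) (_ : decide (j = i) = false), X j) = ⨆ (j : κ) (_ : j ≠ i), X j
    exact iSup_congr fun j ↦ iSup_congr_Prop (by rw [decide_eq_false_iff_not]) fun _ ↦ rfl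
  | true =>
    change (⨆ (j : κ) (_ : decide (j = i) = true), X j) = X i
    rw [show (⨆ (j : κ) (_ : decide (j = i) = true), X j) = ⨆ (j : κ) (_ : j = i), X j from
      iSup_congr fun j ↦ iSup_congr_Prop (by rw [decide_eq_true_iff]) fun _ ↦ rfl]
    exact iSup_iSup_eq_left

/-- **A factor of a product decomposition and the product of the remaining factors form a product pair**:
`(X, η) = (Xᵢ, η|) × (∏_{j ≠ i} Xⱼ, η|)` (grouping, Debarre's Corollaire 2 a) read backwards).
[cite: Debarre1996PolarisationsProduits, Corollaire 2 a)] [cite: Lange2023AbelianVarietiesComplex, §2.4.4 Cor. 2.4.31, p. 125] -/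
theorem IsProductFamily.isProductPair_iSup_ne {κ : Type*} {X : κ → Submodule ℝ (ι → ℝ)} (hX : IsProductFamily Φ η X)
    (hη : IsRiemannForm Φ η) (i : κ) : IsProductPair Φ η (X i) (⨆ (j : κ) (_ : j ≠ i), X j) := by
  classical
  have hf := hX.fiber hη (fun j ↦ decide (j = i))
  rw [pI_fiber_decide_eq X i] at hf
  exact hf.isProductPair

/-- **The factors of a product decomposition of a p.p.a.v. are principally polarised** (`Θ|_{Xᵢ}` is principal:
Lange's «`deg L|_Y = 1`» is necessary, g13-#1). [cite: Lange2023AbelianVarietiesComplex, §2.4.4 Cor. 2.4.31 and §5.3.1 (5.14), pp. 125, 263]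
[cite: ClemensGriffiths1972, §3, p. 293 («`Im ℋ₂` is also unimodular on `U₁^⊥`»)] -/
theorem IsProductFamily.isPrincipalPolarization_restrict {κ : Type*} {X : κ → Submodule ℝ (ι → ℝ)}
    (hX : IsProductFamily Φ η X) (hP : IsPrincipalPolarization Φ η) (i : κ) :
    IsPrincipalPolarization (subtorusPeriod Φ (X i) (hX.isLatticeSubspace i) (hX.isComplexSubspace i))
      (pullbackForm (cxSpan Φ (X i)).subtypeL η) := by
  obtain ⟨_, _, h1, -⟩ := (hP.isProductPair_iff_isPrincipalPolarization_restrict Φ).1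
    (hX.isProductPair_iSup_ne Φ hP.isRiemannForm i)
  exact h1

omit [DecidableEq ι] in
/-- **For a principally polarised abelian subvariety `(Y_U, Θ|_U)`: indecomposable (no product pair inside `U`)
⟺ `U ≠ 0` and irreducible in the sense of Definition 3.22.**
[cite: ClemensGriffiths1972, §3 Def. 3.22 and Cor. 3.23, p. 297] [cite: Debarre1996PolarisationsProduits, p. 631 («indécomposable»)] -/
theorem isIndecomposable_iff_isPolarizedIrreducible {U : Submodule ℝ (ι → ℝ)}
    (hU : IsLatticeSubspace U) (hUc : IsComplexSubspace Φ U)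
    (h1 : IsPrincipalPolarization (subtorusPeriod Φ U hU hUc) (pullbackForm (cxSpan Φ U).subtypeL η)) :
    IsIndecomposable Φ η U ↔
      U ≠ ⊥ ∧ IsPolarizedIrreducible (subtorusPeriod Φ U hU hUc) (pullbackForm (cxSpan Φ U).subtypeL η) := by
  have hR := h1.isRiemannForm
  obtain ⟨B₁, hB₁⟩ := exists_bilinForm_int_of_integral hR.2.1
  rw [isIndecomposable_iff_not_isPolarizedDecomposable hU hUc,
    ComplexTorus.isPolarizedIrreducible_iff_not_isPolarizedDecomposable (subtorusPeriod Φ U hU hUc) hB₁ hR.1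
      ((hR.isUnimodular_iff_isPrincipalPolarization _ hB₁).2 h1)]

/-- For a p.p.a.v. itself: `(X, Θ)` is irreducible (Def. 3.22) iff it is not a product of two non-zero polarised
abelian varieties. [cite: ClemensGriffiths1972, §3 Def. 3.22, p. 297] -/
theorem IsPrincipalPolarization.isPolarizedIrreducible_iff_not_isPolarizedDecomposable
    (hP : IsPrincipalPolarization Φ η) : IsPolarizedIrreducible Φ η ↔ ¬ IsPolarizedDecomposable Φ η := by
  have hR := hP.isRiemannForm
  obtain ⟨B, hB⟩ := exists_bilinForm_int_of_integral hR.2.1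
  exact ComplexTorus.isPolarizedIrreducible_iff_not_isPolarizedDecomposable Φ hB hR.1
    ((hR.isUnimodular_iff_isPrincipalPolarization Φ hB).2 hP)

/-- **Clemens–Griffiths, Corollary 3.23 (first assertion): "If `𝒯` is a principally polarized abelian variety,
`𝒯` has a unique decomposition into the direct sum of irreducible principally polarized abelian varieties."**
There is exactly one set `D` of abelian subvarieties of `(X, Θ)` such that `(X, Θ) = ∏_{Y ∈ D} (Y, Θ|_Y)` (a product
family: pairwise `Θ`-orthogonal complex subtori with `Λ = ⊕ Λ_Y`) and every factor `(Y, Θ|_Y)` — a principally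
polarized abelian variety by `IsProductFamily.isPrincipalPolarization_restrict` — is non-zero and IRREDUCIBLE in the
sense of Definition 3.22. (Existence and uniqueness: the tree's `IsRiemannForm.existsUnique_isProductFamily_isIndecomposable`,
Debarre 1996 / Eichler–Kneser; C–G derive it from the components of `Θ`, Lemma 3.20.)
[cite: ClemensGriffiths1972, §3 Cor. 3.23, p. 297] [cite: Debarre1996PolarisationsProduits, Corollaire 2 b)] -/
theorem IsPrincipalPolarization.clemensGriffiths_3_23 (hP : IsPrincipalPolarization Φ η) :
    ∃! D : Set (Submodule ℝ (ι → ℝ)), IsProductFamily Φ η (fun Y : D ↦ (Y : Submodule ℝ (ι → ℝ))) ∧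
      ∀ Y ∈ D, Y ≠ ⊥ ∧ ∀ (hY : IsLatticeSubspace Y) (hYc : IsComplexSubspace Φ Y),
        IsPolarizedIrreducible (subtorusPeriod Φ Y hY hYc) (pullbackForm (cxSpan Φ Y).subtypeL η) := by
  have hη := hP.isRiemannForm
  have key : ∀ D : Set (Submodule ℝ (ι → ℝ)), IsProductFamily Φ η (fun Y : D ↦ (Y : Submodule ℝ (ι → ℝ))) →
      ((∀ Y ∈ D, IsIndecomposable Φ η Y) ↔ ∀ Y ∈ D, Y ≠ ⊥ ∧ ∀ (hY : IsLatticeSubspace Y)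
        (hYc : IsComplexSubspace Φ Y),
        IsPolarizedIrreducible (subtorusPeriod Φ Y hY hYc) (pullbackForm (cxSpan Φ Y).subtypeL η)) := by
    intro D hD
    refine forall₂_congr fun Y hYD ↦ ?_
    have hY := hD.isLatticeSubspace ⟨Y, hYD⟩
    have hYc := hD.isComplexSubspace ⟨Y, hYD⟩
    have h1 := hD.isPrincipalPolarization_restrict Φ hP ⟨Y, hYD⟩
    rw [isIndecomposable_iff_isPolarizedIrreducible Φ hY hYc h1]
    exact ⟨fun h ↦ ⟨h.1, fun _ _ ↦ h.2⟩, fun h ↦ ⟨h.1, h.2 hY hYc⟩⟩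
  obtain ⟨D, hD, huniq⟩ := hη.existsUnique_isProductFamily_isIndecomposable
  exact ⟨D, ⟨hD.1, (key D hD.1).1 hD.2⟩, fun D' hD' ↦ huniq D' ⟨hD'.1, (key D' hD'.1).2 hD'.2⟩⟩

end Cor323

end ComplexTorus

end Literature.Geometry.Kaehler

end
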